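import Summits.BirchSwinnertonDyer.BirchSwinnertonDyer.Theorems.PrintCf2RamifiedOffTYZLevelTwoGenusPoint
import HarnessLib

/-!
# Route `PrintCf2`, crux stmt-BirchSwinnertonDyer-20509 `RamifiedOffTYZOfFacts` — C⁺ READ IN TIAN–YUAN–ZHANG'S OWN
# MODULUS `2A(ℍ′_n)`: the `(ρ(n), [α_n])` DICHOTOMY of Theorem 3.5's main clause on the jump-one class
# (cell `bsd-print-cf2`, LEAD of 20509 g2, line `offtyz-v7`, lineage cycle 3; fact-free, Theses-free, no `def`)

HONEST FRAMING (cell `bsd-print-cf2`, run/shared/lean/pub/bsd-print-cf2/; route `PrintCf2`; crux 20509 =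
`𝔅_ram → WAllCornerFTwoRamifiedOffTYZProved`, DECIDING, OPEN AS A CLASS): bookkeeping on PRINTED statements taken as
hypotheses on the displayed data `TianYuanZhang2017.GenusPointData` — nothing is asserted, no named fact introduced.
The registered research stub of the line is C⁺ = `stub_offTYZ_levelTwoScriptLExact`: on the jump-one rank-one class
(`n` square-free, `n ≡ 5, 6, 7 (mod 8)`, `ord_{s=1} L(E_n,s) = 1`, `#Sel₂(E_n) = 2⁵`, `#Sel₄(E_n) = 2⁶`) every sign
choice `L` of `𝓛(n)` has `2 ∣ L ∧ 4 ∤ L` — equivalent to `BSD(E_n, 2)` there (door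
`P2.bsdp_two_congruentNumberCurve_iff_two_dvd_not_four_dvd`), OPEN, NO PRINT.  The previous LEAD file
(`PrintCf2RamifiedOffTYZLevelTwoGenusPoint`, g0) read Thm 3.5's main clause `2^{ρ+1}·P(n) − s·𝓛(n)·α_n ∈ A(ℍ′_n)_tor`
in INDEX currency: C⁺ at `n` ⟺ `2^ρ·P(n) ≡ m·α_n (mod tors)` with `m` odd.  THIS FILE reads the same clause in the
quotient `V = A(ℍ′_n)/(2A(ℍ′_n) + A(ℍ′_n)_tor)` — the modulus in which Prop. 3.4, Lemma 3.21 and Tian's induction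
operate ("`x ∈ 2A(ℍ′_n) + A(ℍ′_n)_tor`" is typed as `∃ y, x − 2·y` has finite order; no `def`):

* §1 (LAYER A, any additive commutative group): from `2^{ρ+1}·P − s·L·α ∈ tors`, `s = ±1`:
  `[α] ≠ 0 ⟹ 2^{ρ+1} ∣ L` (`two_pow_dvd_of_not_exists_sub_two_zsmul`); `2^{ρ+2} ∣ L ⟹ [P] = 0`;
  `L = 2^{ρ+1}·odd ⟹ ([P] = 0 ⟺ [α] = 0)`; hence for `ρ = 0` and `[α] ≠ 0`: **`2 ∥ L ⟺ [P] ≠ 0`**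
  (`two_dvd_not_four_dvd_iff_of_not_exists_sub_two_zsmul`), and for `ρ ≥ 1` and `[α] ≠ 0`: `4 ∣ L`.
* §2 (on `E_n`, hypotheses as in g0's file: GZK, `r_an = 1`, `D.thm35Main`, `D.scriptLSpec`, `2^ρ` = the index
  `[E_n(ℚ) : φ_n(A_n(ℚ)) + E_n[2]]`, `α` a generator of the free part of `A(K_n)⁻`, `[α] ≠ 0` in `V`):
  - `two_pow_dvd_of_isScriptL_of_generator_not_twoDivisible`: **`2^{ρ+1} ∣ 𝓛(n)`** — the LOWER half of C⁺ is automatic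
    on the part of the class where the Mordell–Weil generator is not 2-divisible over `ℍ′_n` (no Selmer hypothesis);
  - `levelTwo_iff_genusPoint_not_twoDivisible_of_index_eq_one` (`ρ = 0`): **C⁺ at `n` ⟺ `[P(n)] ≠ 0`**;
  - `four_dvd_of_isScriptL_of_one_le_of_generator_not_twoDivisible` (`ρ ≥ 1`): `4 ∣ 𝓛(n)`, so C⁺ FAILS at `n`; read
    through the exact door on the jump-one class: `generator_twoDivisible_of_bsdp_two_of_one_le` — `BSD(E_n,2)` FORCES
    `[α_n] = 0` whenever `ρ(n) ≥ 1` (a valve; expected vacuous, see the note in its docstring);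
  - `levelTwo_iff_index_eq_one_and_genusPoint_not_twoDivisible`: the dichotomy in one line.
* Sequel file `PrintCf2RamifiedOffTYZLevelTwoGenusPeriod` (through the displayed Prop. 3.4): `[P(n)] = [Σ_main + Σ_I]`,
  and `= [Z(n)]` when the non-trivial weights `∏ g(dᵢ)` are even, whence on `{ρ = 0, [α_n] ≠ 0, even weights}`
  **C⁺ at `n` ⟺ the genus period `Z(n)` is not 2-divisible in `A(ℍ′_n)` modulo torsion.**

What this buys the line (LEAD census, crux 20509): the jump-one class splits as {ρ = 0, [α_n] ≠ 0} (C⁺ is a DEPTH-ONE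
statement there: lower half proved modulo the display, upper half ⟺ `[Z(n)] ≠ 0`) ∪ {ρ = 0, [α_n] = 0} ∪ {ρ = 1}
(C⁺ needs `P(n) mod 4A(ℍ′_n)`, one digit below every display in print — g1's diagnosis made exact).  `[α_n]` is a
Kummer condition on the Mordell–Weil generator relative to the CM tower `ℍ′_n = L_n(i)·∏ H′_{d₀}` (decidable per `n`);
`[Z(n)]` is invisible to the displayed Galois translates (Thm 3.6 / Lemma 3.21 move genus points by `g(d)`-multiples of
`2`-torsion, even on this class).  Beyond-print theorem: NO (bookkeeping of a printed clause); C⁺ itself stays open.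
BSD is not proved by any of this; no class is closed by this file.

References: [cite: TianYuanZhang2017, Thm. 3.5 and Prop. 3.4 (arXiv:1411.4728 chunk p0011 L76–L112), §3.1 (p0011 L27–L73),
Thm. 3.6 (p0012 L22–L40), Lemma 3.21 (p0020 L27–L45)]; [cite: Darmon2004, Thm. 3.22] (GZK, binder `hGZK`);
[cite: Miller2011LMS, Def. 1.1]; tree: `TianYuanZhang2017/GenusPointDescentDisplays.lean`,
`Theorems/PrintCf2RamifiedOffTYZLevelTwoGenusPoint.lean` (g0), `Rank1Residual/P2/CongruentNumberLevelTwoDoor.lean`.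
-/

noncomputable section

open scoped Classical

open WeierstrassCurve WeierstrassCurve.Affine Literature.NumberTheory.EllipticCurves
  Literature.NumberTheory.EllipticCurves.Rank1Residual Summit.BirchSwinnertonDyer.Rank1Residual
  Literature.NumberTheory.EllipticCurves.TianYuanZhang2017
  Literature.NumberTheory.EllipticCurves.TianYuanZhang2017.W2

set_option autoImplicit false

namespace Summit.BirchSwinnertonDyer.PrintCf2.LevelTwoModTwo

/-! ## §1 Layer A: a torsion relation `2^{ρ+1}·P − s·L·α ∈ tors` read modulo `2G + G_tor` -/

section Abstract

variable {G : Type*} [AddCommGroup G]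

/-- If `2·Q − m·α` has finite order with `m` ODD, then `α ∈ 2G + G_tor` (`α − 2·y` has finite order for some `y`).
[folklore] -/
theorem exists_sub_two_zsmul_of_odd {Q α : G} {m : ℤ} (hm : Odd m)
    (h : IsOfFinAddOrder ((2 : ℤ) • Q - m • α)) : ∃ y : G, IsOfFinAddOrder (α - (2 : ℤ) • y) := by
  obtain ⟨j, rfl⟩ := hm
  refine ⟨Q - j • α, ?_⟩
  have e : α - (2 : ℤ) • (Q - j • α) = -((2 : ℤ) • Q - (2 * j + 1) • α) := by module
  rw [e]
  exact h.neg

/-- `P ≡ c·α` modulo torsion with `c` ODD ⟹ (`P ∈ 2G + G_tor ⟺ α ∈ 2G + G_tor`). [folklore] -/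
theorem exists_sub_two_zsmul_iff_of_odd {P α : G} {c : ℤ} (hc : Odd c)
    (h : IsOfFinAddOrder (P - c • α)) :
    (∃ y : G, IsOfFinAddOrder (P - (2 : ℤ) • y)) ↔ ∃ y : G, IsOfFinAddOrder (α - (2 : ℤ) • y) := by
  obtain ⟨j, rfl⟩ := hc
  constructor
  · rintro ⟨y, hy⟩
    refine ⟨y - j • α, ?_⟩
    have e : α - (2 : ℤ) • (y - j • α) = (P - (2 : ℤ) • y) + -(P - (2 * j + 1) • α) := by module
    rw [e]
    exact hy.add h.neg
  · rintro ⟨y, hy⟩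
    refine ⟨(2 * j + 1) • y, ?_⟩
    have e : P - (2 : ℤ) • ((2 * j + 1) • y) = (P - (2 * j + 1) • α) + (2 * j + 1) • (α - (2 : ℤ) • y) := by
      module
    rw [e]
    exact h.add hy.zsmul

/-- **The lower bound.** If `2^{ρ+1}·P − (s·L)·α` has finite order with `s = ±1` and `α ∉ 2G + G_tor`, then
`2^{ρ+1} ∣ L`. (Read on `A(ℍ′_n)`: a Mordell–Weil generator NOT 2-divisible over `ℍ′_n` forces
`2^{ρ(n)+1} ∣ 𝓛(n)`, in particular `2 ∣ 𝓛(n)`.) [folklore] -/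
theorem two_pow_dvd_of_not_exists_sub_two_zsmul {P α : G} {ρ : ℕ} {L s : ℤ} (hs : s = 1 ∨ s = -1)
    (hrel : IsOfFinAddOrder (((2 : ℤ) ^ (ρ + 1)) • P - (s * L) • α))
    (hα : ¬ ∃ y : G, IsOfFinAddOrder (α - (2 : ℤ) • y)) : (2 : ℤ) ^ (ρ + 1) ∣ L := by
  -- by induction: `2^k ∣ s·L` for every `k ≤ ρ + 1`
  have key : ∀ k : ℕ, k ≤ ρ + 1 → (2 : ℤ) ^ k ∣ s * L := by
    intro k
    induction k with
    | zero => intro; simp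
    | succ k ih =>
      intro hk
      obtain ⟨c, hc⟩ := ih (Nat.le_of_succ_le hk)
      -- if `c` were odd, `α` would be `2`-divisible modulo torsion
      rcases Int.even_or_odd c with ⟨c', hc'⟩ | hodd
      · exact ⟨c', by rw [hc, hc', pow_succ]; ring⟩
      · exfalso
        apply hα
        obtain ⟨j, hj⟩ : ∃ j, ρ = k + j := ⟨ρ - k, by omega⟩
        have e : ((2 : ℤ) ^ (ρ + 1)) • P - (s * L) • α =
            ((2 : ℤ) ^ k) • ((2 : ℤ) • (((2 : ℤ) ^ j) • P) - c • α) := by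
          rw [hc, hj, show ((2 : ℤ) ^ (k + j + 1)) = 2 ^ k * (2 * 2 ^ j) by ring]
          module
        rw [e] at hrel
        exact exists_sub_two_zsmul_of_odd hodd (LevelTwo.isOfFinAddOrder_of_zsmul (pow_ne_zero _ two_ne_zero) hrel)
  have h := key (ρ + 1) le_rfl
  rcases hs with rfl | rfl
  · simpa using h
  · rw [neg_one_mul] at h
    exact (dvd_neg).mp h

/-- If `2^{ρ+1}·P − (s·L)·α` has finite order and `L = 2^{ρ+1}·m`, then `P − (s·m)·α` has finite order. [folklore] -/
theorem isOfFinAddOrder_sub_of_eq_two_pow_mul {P α : G} {ρ : ℕ} {L s m : ℤ} (hL : L = 2 ^ (ρ + 1) * m)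
    (hrel : IsOfFinAddOrder (((2 : ℤ) ^ (ρ + 1)) • P - (s * L) • α)) :
    IsOfFinAddOrder (P - (s * m) • α) := by
  have e : ((2 : ℤ) ^ (ρ + 1)) • P - (s * L) • α = ((2 : ℤ) ^ (ρ + 1)) • (P - (s * m) • α) := by
    rw [hL]; module
  rw [e] at hrel
  exact LevelTwo.isOfFinAddOrder_of_zsmul (pow_ne_zero _ two_ne_zero) hrel

/-- **The upper digit.** If `2^{ρ+1}·P − (s·L)·α` has finite order and `2^{ρ+2} ∣ L`, then `P ∈ 2G + G_tor`. [folklore] -/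
theorem exists_sub_two_zsmul_of_two_pow_succ_dvd {P α : G} {ρ : ℕ} {L s : ℤ}
    (hrel : IsOfFinAddOrder (((2 : ℤ) ^ (ρ + 1)) • P - (s * L) • α)) (h4 : (2 : ℤ) ^ (ρ + 2) ∣ L) :
    ∃ y : G, IsOfFinAddOrder (P - (2 : ℤ) • y) := by
  obtain ⟨j, hj⟩ := h4
  refine ⟨(s * j) • α, ?_⟩
  have hL : L = 2 ^ (ρ + 1) * (2 * j) := by rw [hj]; ring
  have h := isOfFinAddOrder_sub_of_eq_two_pow_mul hL hrel
  have e : P - (2 : ℤ) • ((s * j) • α) = P - (s * (2 * j)) • α := by module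
  rwa [e]

/-- **The digit `ρ + 1` exactly.** If `2^{ρ+1}·P − (s·L)·α` has finite order with `s = ±1` and `L = 2^{ρ+1}·m` with
`m` odd, then `P ≡ α` modulo `2G + G_tor`: (`P ∈ 2G + G_tor ⟺ α ∈ 2G + G_tor`). [folklore] -/
theorem exists_sub_two_zsmul_iff_of_eq_two_pow_mul_odd {P α : G} {ρ : ℕ} {L s m : ℤ} (hs : s = 1 ∨ s = -1)
    (hm : Odd m) (hL : L = 2 ^ (ρ + 1) * m)
    (hrel : IsOfFinAddOrder (((2 : ℤ) ^ (ρ + 1)) • P - (s * L) • α)) :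
    (∃ y : G, IsOfFinAddOrder (P - (2 : ℤ) • y)) ↔ ∃ y : G, IsOfFinAddOrder (α - (2 : ℤ) • y) := by
  have hsm : Odd (s * m) := by
    rcases hs with rfl | rfl
    · simpa using hm
    · simpa using hm.neg
  exact exists_sub_two_zsmul_iff_of_odd hsm (isOfFinAddOrder_sub_of_eq_two_pow_mul hL hrel)

/-- **The `ρ = 0` dichotomy (abstract C⁺).** If `2·P − (s·L)·α` has finite order with `s = ±1` and `α ∉ 2G + G_tor`,
then `2 ∣ L ∧ 4 ∤ L ⟺ P ∉ 2G + G_tor`. (Read on `A(ℍ′_n)` for `ρ(n) = 0`: C⁺ at `n` ⟺ the point `P(n)` is not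
2-divisible over `ℍ′_n` modulo torsion.) [folklore] -/
theorem two_dvd_not_four_dvd_iff_of_not_exists_sub_two_zsmul {P α : G} {L s : ℤ} (hs : s = 1 ∨ s = -1)
    (hrel : IsOfFinAddOrder ((2 : ℤ) • P - (s * L) • α))
    (hα : ¬ ∃ y : G, IsOfFinAddOrder (α - (2 : ℤ) • y)) :
    ((2 : ℤ) ∣ L ∧ ¬ (4 : ℤ) ∣ L) ↔ ¬ ∃ y : G, IsOfFinAddOrder (P - (2 : ℤ) • y) := by
  have hrel' : IsOfFinAddOrder (((2 : ℤ) ^ (0 + 1)) • P - (s * L) • α) := by simpa using hrel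
  constructor
  · rintro ⟨⟨m, rfl⟩, h4⟩ hP
    have hm : Odd m := by
      rcases Int.even_or_odd m with ⟨j, hj⟩ | hodd
      · exact absurd ⟨j, by rw [hj]; ring⟩ h4
      · exact hodd
    have hL : (2 : ℤ) * m = 2 ^ (0 + 1) * m := by ring
    exact hα ((exists_sub_two_zsmul_iff_of_eq_two_pow_mul_odd hs hm hL hrel').mp hP)
  · intro hP
    refine ⟨by simpa using two_pow_dvd_of_not_exists_sub_two_zsmul hs hrel' hα, fun h4 => hP ?_⟩
    exact exists_sub_two_zsmul_of_two_pow_succ_dvd hrel' (by simpa using h4)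

/-- **The `ρ ≥ 1` valve.** If `2^{ρ+1}·P − (s·L)·α` has finite order with `s = ±1`, `1 ≤ ρ`, and `α ∉ 2G + G_tor`, then
`4 ∣ L` — so `2 ∥ L` FAILS. (Read on `A(ℍ′_n)`: on the part `ρ(n) ≥ 1` of the jump-one class, C⁺ — equivalently
`BSD(E_n, 2)` — forces the Mordell–Weil generator to be 2-divisible over `ℍ′_n` modulo torsion.) [folklore] -/
theorem four_dvd_of_one_le_of_not_exists_sub_two_zsmul {P α : G} {ρ : ℕ} {L s : ℤ} (hs : s = 1 ∨ s = -1)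
    (hρ : 1 ≤ ρ) (hrel : IsOfFinAddOrder (((2 : ℤ) ^ (ρ + 1)) • P - (s * L) • α))
    (hα : ¬ ∃ y : G, IsOfFinAddOrder (α - (2 : ℤ) • y)) : (4 : ℤ) ∣ L := by
  have h := two_pow_dvd_of_not_exists_sub_two_zsmul hs hrel hα
  exact (pow_dvd_pow (2 : ℤ) (show 2 ≤ ρ + 1 by omega)).trans h |> fun h' => by simpa using h'

/-- Contrapositive of the valve: `2 ∣ L ∧ 4 ∤ L` with `1 ≤ ρ` forces `α ∈ 2G + G_tor`. [folklore] -/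
theorem exists_sub_two_zsmul_of_one_le_of_two_dvd_not_four_dvd {P α : G} {ρ : ℕ} {L s : ℤ}
    (hs : s = 1 ∨ s = -1) (hρ : 1 ≤ ρ) (hrel : IsOfFinAddOrder (((2 : ℤ) ^ (ρ + 1)) • P - (s * L) • α))
    (hL : (2 : ℤ) ∣ L ∧ ¬ (4 : ℤ) ∣ L) : ∃ y : G, IsOfFinAddOrder (α - (2 : ℤ) • y) := by
  by_contra hα
  exact hL.2 (four_dvd_of_one_le_of_not_exists_sub_two_zsmul hs hρ hrel hα)

/-- `P ≡ P′ (mod 2G)` transports `2`-divisibility modulo torsion. [folklore] -/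
theorem exists_sub_two_zsmul_iff_of_sub_eq_two_smul {P P' Q : G} (h : P - P' = (2 : ℕ) • Q) :
    (∃ y : G, IsOfFinAddOrder (P - (2 : ℤ) • y)) ↔ ∃ y : G, IsOfFinAddOrder (P' - (2 : ℤ) • y) := by
  have hP : P = P' + (2 : ℤ) • Q := by
    rw [show (2 : ℤ) = ((2 : ℕ) : ℤ) from rfl, natCast_zsmul]
    exact sub_eq_iff_eq_add'.mp h
  constructor
  · rintro ⟨y, hy⟩
    refine ⟨y - Q, ?_⟩
    have e : P' - (2 : ℤ) • (y - Q) = P - (2 : ℤ) • y := by rw [hP]; module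
    rwa [e]
  · rintro ⟨y, hy⟩
    refine ⟨y + Q, ?_⟩
    have e : P - (2 : ℤ) • (y + Q) = P' - (2 : ℤ) • y := by rw [hP]; module
    rwa [e]

end Abstract

/-! ## §2 The reading on `E_n`: the `(ρ(n), [α_n])` dichotomy of Thm 3.5's main clause -/

section EnSide

variable {n : ℕ}

/-- **LOWER BOUND FROM A NON-2-DIVISIBLE GENERATOR.** Square-free `n ≡ 5, 6, 7 (mod 8)` with `ord_{s=1} L(E_n, s) = 1`;
GZK; data `D : GenusPointData n` with the displayed main clause of Thm 3.5 (`h35`) and integrality (`hLs`);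
`2^ρ = [E_n(ℚ) : φ_n(A_n(ℚ)) + E_n[2]]`; `α` a generator of the free part of `A(K_n)⁻`.  If `α`, read in `A(ℍ′_n)`, is
NOT 2-divisible modulo torsion (`α ∉ 2A(ℍ′_n) + A(ℍ′_n)_tor`), then **`2^{ρ+1} ∣ L` for every sign choice `L` of `𝓛(n)`** —
in particular `2 ∣ 𝓛(n)`, the lower half of C⁺, with no hypothesis on Selmer groups.
[cite: TianYuanZhang2017, Thm. 3.5 (arXiv:1411.4728 chunk p0011 L94–L100) and §3.1 (p0011 L27–L36)] [cite: Darmon2004, Thm. 3.22] -/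
theorem two_pow_dvd_of_isScriptL_of_generator_not_twoDivisible
    (hGZK : rank_eq_analyticRank_of_analyticRank_le_one) (hsq : Squarefree n)
    (h8 : n % 8 = 5 ∨ n % 8 = 6 ∨ n % 8 = 7) (hr : (congruentNumberCurve n).analyticRank = 1)
    (D : GenusPointData n) (h35 : D.thm35Main) (hLs : D.scriptLSpec) {ρ : ℕ} (hρ : (rhoSubgroup n).index = 2 ^ ρ)
    {α : APoint (GenusField n)} (hα : GeneratesFreePart n α)
    (hα2 : ¬ ∃ y : APoint D.H, IsOfFinAddOrder
      (Point.map (W' := curveA) (D.embK n (Nat.mem_divisors_self n hsq.ne_zero)) α - (2 : ℤ) • y))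
    {L : ℤ} (hL : IsScriptL n L) : (2 : ℤ) ^ (ρ + 1) ∣ L := by
  haveI := isElliptic_congruentNumberCurve hsq.ne_zero
  have hn : n ∈ n.divisors := Nat.mem_divisors_self n hsq.ne_zero
  have hn1 : 1 < n := by rcases h8 with h | h | h <;> omega
  have hLD : IsScriptL n (D.scriptL n) := hLs n hn hn1
  have hL0 : D.scriptL n ≠ 0 := (P2.bsdp_two_congruentNumberCurve_iff_of_isScriptL hGZK hsq hr hLD).2.2.1
  obtain ⟨s, hs, hrel⟩ := ((h35 hn ρ hρ).2 hL0) α hα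
  have hD : (2 : ℤ) ^ (ρ + 1) ∣ D.scriptL n := two_pow_dvd_of_not_exists_sub_two_zsmul hs hrel hα2
  rcases LevelTwo.eq_or_eq_neg_of_isScriptL hL hLD with rfl | rfl
  · exact hD
  · exact (dvd_neg).mpr hD

/-- **THE `ρ = 0` DICHOTOMY ON `E_n`.** Same data, with `[E_n(ℚ) : φ_n(A_n(ℚ)) + E_n[2]] = 1` (`ρ(n) = 0`) and the generator
`α` NOT 2-divisible in `A(ℍ′_n)` modulo torsion.  Then the conclusion of C⁺ at `n` — `2 ∣ L ∧ 4 ∤ L` for every sign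
choice `L` of `𝓛(n)` — holds **iff the point `P(n)` is NOT 2-divisible in `A(ℍ′_n)` modulo torsion**
(`P(n) ∉ 2A(ℍ′_n) + A(ℍ′_n)_tor`): a statement in Tian–Yuan–Zhang's own modulus `2A(ℍ′_n)` (the modulus of Prop. 3.4),
one 2-adic digit LOWER than the index form of C⁺.
[cite: TianYuanZhang2017, Thm. 3.5 (chunk p0011 L94–L100), Prop. 3.4 (p0011 L76–L89)] [cite: Darmon2004, Thm. 3.22] -/
theorem levelTwo_iff_genusPoint_not_twoDivisible_of_index_eq_one
    (hGZK : rank_eq_analyticRank_of_analyticRank_le_one) (hsq : Squarefree n)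
    (h8 : n % 8 = 5 ∨ n % 8 = 6 ∨ n % 8 = 7) (hr : (congruentNumberCurve n).analyticRank = 1)
    (D : GenusPointData n) (h35 : D.thm35Main) (hLs : D.scriptLSpec) (hρ0 : (rhoSubgroup n).index = 1)
    {α : APoint (GenusField n)} (hα : GeneratesFreePart n α)
    (hα2 : ¬ ∃ y : APoint D.H, IsOfFinAddOrder
      (Point.map (W' := curveA) (D.embK n (Nat.mem_divisors_self n hsq.ne_zero)) α - (2 : ℤ) • y)) :
    (∀ L : ℤ, IsScriptL n L → (2 : ℤ) ∣ L ∧ ¬ (4 : ℤ) ∣ L) ↔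
      ¬ ∃ y : APoint D.H, IsOfFinAddOrder (D.P n - (2 : ℤ) • y) := by
  haveI := isElliptic_congruentNumberCurve hsq.ne_zero
  have hn : n ∈ n.divisors := Nat.mem_divisors_self n hsq.ne_zero
  have hn1 : 1 < n := by rcases h8 with h | h | h <;> omega
  have hLD : IsScriptL n (D.scriptL n) := hLs n hn hn1
  have hL0 : D.scriptL n ≠ 0 := (P2.bsdp_two_congruentNumberCurve_iff_of_isScriptL hGZK hsq hr hLD).2.2.1
  have hρ : (rhoSubgroup n).index = 2 ^ 0 := by simpa using hρ0
  obtain ⟨s, hs, hrel⟩ := ((h35 hn 0 hρ).2 hL0) α hα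
  have hrel' : IsOfFinAddOrder ((2 : ℤ) • D.P n -
      (s * D.scriptL n) • Point.map (W' := curveA) (D.embK n hn) α) := by simpa using hrel
  have key := two_dvd_not_four_dvd_iff_of_not_exists_sub_two_zsmul hs hrel' hα2
  constructor
  · intro h
    exact key.mp (h (D.scriptL n) hLD)
  · intro hP L hL
    exact LevelTwo.two_dvd_not_four_dvd_of_eq_or_eq_neg (LevelTwo.eq_or_eq_neg_of_isScriptL hL hLD) (key.mpr hP)

/-- **THE `ρ ≥ 1` VALVE ON `E_n`.** Same data, with `[E_n(ℚ) : φ_n(A_n(ℚ)) + E_n[2]] = 2^ρ`, `ρ ≥ 1`, and the generator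
`α` NOT 2-divisible in `A(ℍ′_n)` modulo torsion: then **`4 ∣ L`** for every sign choice `L` of `𝓛(n)` — the conclusion of C⁺
FAILS at `n`.  (Expected to be vacuous: for `ρ(n) = 1` the generator is `φ̂_n` of a point of `E_n(ℚ)` up to torsion,
hence twice a point over `ℚ(√x)` with `x ∈ ⟨−1, 2, p ∣ n⟩`, and `L_n(i) = ℚ(i, √d : d ∣ n) ⊂ ℍ′_n` together with the
torsion classes of `τ(½)`, `[i]τ(½)` absorb the class — LEAD note, not kernel-checked; the theorem is the honest valve.)
[cite: TianYuanZhang2017, Thm. 3.5 (chunk p0011 L94–L100), §1 (p0002 L101–L110)] [cite: Darmon2004, Thm. 3.22] -/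
theorem four_dvd_of_isScriptL_of_one_le_of_generator_not_twoDivisible
    (hGZK : rank_eq_analyticRank_of_analyticRank_le_one) (hsq : Squarefree n)
    (h8 : n % 8 = 5 ∨ n % 8 = 6 ∨ n % 8 = 7) (hr : (congruentNumberCurve n).analyticRank = 1)
    (D : GenusPointData n) (h35 : D.thm35Main) (hLs : D.scriptLSpec) {ρ : ℕ} (hρ : (rhoSubgroup n).index = 2 ^ ρ)
    (h1 : 1 ≤ ρ) {α : APoint (GenusField n)} (hα : GeneratesFreePart n α)
    (hα2 : ¬ ∃ y : APoint D.H, IsOfFinAddOrder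
      (Point.map (W' := curveA) (D.embK n (Nat.mem_divisors_self n hsq.ne_zero)) α - (2 : ℤ) • y))
    {L : ℤ} (hL : IsScriptL n L) : (4 : ℤ) ∣ L := by
  have h := two_pow_dvd_of_isScriptL_of_generator_not_twoDivisible hGZK hsq h8 hr D h35 hLs hρ hα hα2 hL
  have h4 : (4 : ℤ) ∣ (2 : ℤ) ^ (ρ + 1) := by
    simpa using pow_dvd_pow (2 : ℤ) (show 2 ≤ ρ + 1 by omega)
  exact h4.trans h

/-- **THE DICHOTOMY IN ONE LINE.** Same data, generator `α` NOT 2-divisible in `A(ℍ′_n)` modulo torsion, `2^ρ` the index: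
the conclusion of C⁺ at `n` holds **iff `ρ = 0` and `P(n) ∉ 2A(ℍ′_n) + A(ℍ′_n)_tor`**.
[cite: TianYuanZhang2017, Thm. 3.5 (chunk p0011 L94–L100)] [cite: Darmon2004, Thm. 3.22] -/
theorem levelTwo_iff_index_eq_one_and_genusPoint_not_twoDivisible
    (hGZK : rank_eq_analyticRank_of_analyticRank_le_one) (hsq : Squarefree n)
    (h8 : n % 8 = 5 ∨ n % 8 = 6 ∨ n % 8 = 7) (hr : (congruentNumberCurve n).analyticRank = 1)
    (D : GenusPointData n) (h35 : D.thm35Main) (hLs : D.scriptLSpec) {ρ : ℕ} (hρ : (rhoSubgroup n).index = 2 ^ ρ)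
    {α : APoint (GenusField n)} (hα : GeneratesFreePart n α)
    (hα2 : ¬ ∃ y : APoint D.H, IsOfFinAddOrder
      (Point.map (W' := curveA) (D.embK n (Nat.mem_divisors_self n hsq.ne_zero)) α - (2 : ℤ) • y)) :
    (∀ L : ℤ, IsScriptL n L → (2 : ℤ) ∣ L ∧ ¬ (4 : ℤ) ∣ L) ↔
      (ρ = 0 ∧ ¬ ∃ y : APoint D.H, IsOfFinAddOrder (D.P n - (2 : ℤ) • y)) := by
  have hn : n ∈ n.divisors := Nat.mem_divisors_self n hsq.ne_zero
  have hn1 : 1 < n := by rcases h8 with h | h | h <;> omega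
  have hLD : IsScriptL n (D.scriptL n) := hLs n hn hn1
  rcases Nat.eq_zero_or_pos ρ with rfl | hpos
  · have hρ0 : (rhoSubgroup n).index = 1 := by simpa using hρ
    rw [levelTwo_iff_genusPoint_not_twoDivisible_of_index_eq_one hGZK hsq h8 hr D h35 hLs hρ0 hα hα2]
    simp
  · constructor
    · intro h
      exact absurd (four_dvd_of_isScriptL_of_one_le_of_generator_not_twoDivisible hGZK hsq h8 hr D h35 hLs hρ
        hpos hα hα2 hLD) (h (D.scriptL n) hLD).2
    · rintro ⟨rfl, -⟩
      exact absurd rfl (Nat.pos_iff_ne_zero.mp hpos)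

/-- **`BSD(E_n, 2)` READS THE VALVE.** On the jump-one rank-one class (`#Sel₂(E_n) = 2⁵`, `#Sel₄(E_n) = 2⁶`, where the door
`P2.bsdp_two_congruentNumberCurve_iff_two_dvd_not_four_dvd` is exact), if `[E_n(ℚ) : φ_n(A_n(ℚ)) + E_n[2]] = 2^ρ` with
`ρ ≥ 1`, then `BSD(E_n, 2)` FORCES every generator `α` of the free part of `A(K_n)⁻` to be 2-divisible in `A(ℍ′_n)` modulo
torsion (for every data `D` with Thm 3.5's main clause).  Contrapositively, a member with `ρ(n) ≥ 1` and a generator that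
is not 2-divisible over `ℍ′_n` modulo torsion would REFUTE `BSD(E_n, 2)` — the disprover's handle.
[cite: TianYuanZhang2017, Thm. 3.5 (chunk p0011 L94–L100)] [cite: Miller2011LMS, Def. 1.1] [cite: Darmon2004, Thm. 3.22] -/
theorem generator_twoDivisible_of_bsdp_two_of_one_le
    (hGZK : rank_eq_analyticRank_of_analyticRank_le_one) (hsq : Squarefree n)
    (h8 : n % 8 = 5 ∨ n % 8 = 6 ∨ n % 8 = 7) [(congruentNumberCurve n).IsElliptic]
    (hr : (congruentNumberCurve n).analyticRank = 1)
    (hS₂ : Nat.card ((congruentNumberCurve n).selmerGroup 2) = 2 ^ 5)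
    (hS₄ : Nat.card ((congruentNumberCurve n).selmerGroup 4) = 2 ^ 6)
    (D : GenusPointData n) (h35 : D.thm35Main) (hLs : D.scriptLSpec) {ρ : ℕ} (hρ : (rhoSubgroup n).index = 2 ^ ρ)
    (h1 : 1 ≤ ρ) {α : APoint (GenusField n)} (hα : GeneratesFreePart n α)
    (hB : BSDp (congruentNumberCurve n) 2) :
    ∃ y : APoint D.H, IsOfFinAddOrder
      (Point.map (W' := curveA) (D.embK n (Nat.mem_divisors_self n hsq.ne_zero)) α - (2 : ℤ) • y) := by
  have hn : n ∈ n.divisors := Nat.mem_divisors_self n hsq.ne_zero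
  have hn1 : 1 < n := by rcases h8 with h | h | h <;> omega
  have hLD : IsScriptL n (D.scriptL n) := hLs n hn hn1
  by_contra hα2
  have h4 := four_dvd_of_isScriptL_of_one_le_of_generator_not_twoDivisible hGZK hsq h8 hr D h35 hLs hρ h1 hα hα2 hLD
  exact ((P2.bsdp_two_congruentNumberCurve_iff_two_dvd_not_four_dvd hGZK hsq hr hLD hS₂ hS₄).mp hB).2 h4

end EnSide


end Summit.BirchSwinnertonDyer.PrintCf2.LevelTwoModTwo

end
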